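import Summits.BirchSwinnertonDyer.BirchSwinnertonDyer.Theses.PrintX10b
import Summits.BirchSwinnertonDyer.BirchSwinnertonDyer.Theorems.PrintX10bHowardContainmentPinnedOfFlachLeafIntended
import HarnessLib

/-!
# PrintX10b — entry (closer) for the glue item `HowardContainmentLightFrameX10bPinnedOfFlachLeavesIntended` (T-141″-KSX10b)

Route `PrintX10b`, pen plan g16's r8″ consolidation round («hH → h141″», keyed on Howard 2004 Prop. 1.4.1 / Flach 1990
print-as-INTENDED, C45.1″ `Literature.NumberTheory.GaloisCohomology.Howard2004.prop141_casselsTate_skewPairing_atLevel_printIntended`,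
lit g46 p722866).  ONE line over x9-p1 LEAD g10's DISPLAY-PROP141″-X10b theorem
`PrintX10bOfFlachLeafIntended.howardContainmentLightFrameX10bPinned_of_prop141Intended_kolyvaginSystem_cgs` (G5″, p723345):
C45.1″ → CGLS 2022 Thm. 4.1.1 (Kolyvagin-system form) → CGS 2025 Thm. 6.5.2 (p-localized) → the pinned light-frame
containment `HowardContainmentLightFrameX10bPinned`, with Howard's Thm. 1.6.1-as-intended a KERNEL theorem of the cell's G87
engine (`DVRSetting.thm161_printIntended_of_prop141_printIntended`, w7 g12 p723075, over w2 g17 p720105) and the tree's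
Poitou–Tate theorem.  Cell `pub/bsd-print-x9`, seat `bsd-line-x10b-p2` LEAD g16 (CLAIM 2026-08-29T12:18:31Z; pen g16 13:57:47Z
«X10b closer → x10b-p2 LEAD»).  GLUE ONLY: the three print leaves stay hypotheses of `closes`; no print leaf is discharged;
no summit statement is proved; BSD is not proved by this.
-/

set_option linter.dupNamespace false

namespace Summit.BirchSwinnertonDyer.BirchSwinnertonDyer.Theorems.PrintX10bFlachLeavesIntendedEntry

open Summit.BirchSwinnertonDyer.BirchSwinnertonDyer.Theses.PrintX10b

/-- `HowardContainmentLightFrameX10bPinnedOfFlachLeavesIntended` holds: one line over the DISPLAY-PROP141″-X10b theorem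
`PrintX10bOfFlachLeafIntended.howardContainmentLightFrameX10bPinned_of_prop141Intended_kolyvaginSystem_cgs` (p723345) —
C45.1″ (Howard Prop. 1.4.1 / Flach, print-as-intended) → CGLS Thm. 4.1.1 (KS form) → CGS Thm. 6.5.2 (p-localized) → the
pinned light-frame containment.  GLUE only; the three print leaves stay hypotheses; BSD is not proved by this.
[cite: Howard2004HeegnerKolyvagin, Prop. 1.4.1, Thm. 1.4.2 and Thm. 1.6.1] [cite: CastellaGrossiLeeSkinner2022, Thm. 4.1.1]
[cite: CastellaGrossiSkinner2025, Thm. 6.5.2] -/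
theorem howardContainmentLightFrameX10bPinnedOfFlachLeavesIntended_holds :
    HowardContainmentLightFrameX10bPinnedOfFlachLeavesIntended :=
  fun h141 hK hCGS =>
    Summit.BirchSwinnertonDyer.BirchSwinnertonDyer.Theorems.PrintX10bOfFlachLeafIntended.howardContainmentLightFrameX10bPinned_of_prop141Intended_kolyvaginSystem_cgs
      h141 hK hCGS

end Summit.BirchSwinnertonDyer.BirchSwinnertonDyer.Theorems.PrintX10bFlachLeavesIntendedEntry
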